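import Literature.Analysis.FluidPDE.KatoViscosityScaling
import Summits.NavierStokesRegularity.NavierStokesRegularity.Theorems.L3TimeExponentPincerNoSwirlKatoGlobal
import HarnessLib.Audit
import HarnessLib

/-!
# `AxisymmetricKatoGlobal` (stmt-NavierStokesRegularity-15453): the SWIRL-FREE stratum of the crux is a theorem, for every viscosity

Helper for the crux `AxisymmetricExtremality.AxisymmetricKatoGlobal` («every axisymmetric, weakly
divergence-free `u₀ ∈ L³` (represented in `Ḣ^{1/2}`) has a global Kato solution, for every
`ν > 0`»).  Its swirl-free stratum holds unconditionally: by
`…L3TimeExponentPincerNoSwirlKatoGlobal.hasGlobalKatoSolution_of_isAxisymmetric_hasNoSwirl`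
(`ν = 1`: the crux line's own Kato-class machinery + Seregin's 2022 criterion at vanishing swirl)
and the viscosity scaling of Kato's class (`hasGlobalKatoSolution_smul_iff`: `a • u₀` at viscosity
`a ν` iff `u₀` at `ν`), since `ν⁻¹ • u₀` is again axisymmetric, swirl-free, weakly divergence free
and in `L³`.

* `hasGlobalKatoSolution_of_isAxisymmetric_hasNoSwirl_viscosity` — `T_max = ∞` for swirl-free
  axisymmetric weakly divergence-free `u₀ ∈ L³`, every `ν > 0`;
* `axisymmetricKatoGlobal_noSwirl_stratum` — the crux's conclusion under the extra hypothesis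
  `HasNoSwirl u₀` (the `Ḣ^{1/2}` representation hypothesis of the crux is not needed).

WHAT THIS IS NOT: not the crux (data WITH swirl — `stub_swirlAxisModulus` — untouched); the
swirl-free class is classically regular (Ladyzhenskaya 1968, Ukhovskii–Yudovich 1968); this is its
critical `L³`/Kato form; no crux claim.
-/

noncomputable section

open Set MeasureTheory Filter Topology Function
open scoped ENNReal NNReal
open Literature.Analysis.FluidPDE

namespace Summit.NavierStokesRegularity.NavierStokesRegularity.Theorems.AxisymmetricKatoGlobal.NoSwirlStratum

open Summit.NavierStokesRegularity.NavierStokesRegularity.Theorems.L3TimeExponentPincerNoSwirlKatoGlobal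

/-- Scalar multiples of an axisymmetric field are axisymmetric. -/
theorem isAxisymmetric_const_smul {u₀ : EuclideanSpace ℝ (Fin 3) → EuclideanSpace ℝ (Fin 3)}
    (h : IsAxisymmetric u₀) (a : ℝ) : IsAxisymmetric (a • u₀) := by
  intro θ x
  simp only [Pi.smul_apply, h θ x]
  ext i
  fin_cases i <;> simp [rotZ_apply_zero, rotZ_apply_one] <;> ring

/-- Scalar multiples of a swirl-free field are swirl-free. -/
theorem hasNoSwirl_const_smul {u₀ : EuclideanSpace ℝ (Fin 3) → EuclideanSpace ℝ (Fin 3)}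
    (h : HasNoSwirl u₀) (a : ℝ) : HasNoSwirl (a • u₀) := by
  intro x
  have hx := h x
  simp only [swirl, Pi.smul_apply, PiLp.smul_apply, smul_eq_mul] at hx ⊢
  have : x 0 * (a * u₀ x 1) - x 1 * (a * u₀ x 0) = a * (x 0 * u₀ x 1 - x 1 * u₀ x 0) := by ring
  rw [this, hx, mul_zero]

/-- **`T_max = ∞` for swirl-free axisymmetric `L³` data, every viscosity `ν > 0`.** -/
theorem hasGlobalKatoSolution_of_isAxisymmetric_hasNoSwirl_viscosity {ν : ℝ} (hν : 0 < ν)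
    {u₀ : EuclideanSpace ℝ (Fin 3) → EuclideanSpace ℝ (Fin 3)} (hu₀ : MemLp u₀ 3 volume)
    (hdiv : IsWeaklyDivFree u₀) (hax : IsAxisymmetric u₀) (hsw : HasNoSwirl u₀) :
    HasGlobalKatoSolution ν u₀ := by
  -- `ν⁻¹ • u₀` at unit viscosity
  have h1 : HasGlobalKatoSolution 1 (ν⁻¹ • u₀) :=
    hasGlobalKatoSolution_of_isAxisymmetric_hasNoSwirl (hu₀.const_smul ν⁻¹) (hdiv.const_smul ν⁻¹)
      (isAxisymmetric_const_smul hax ν⁻¹) (hasNoSwirl_const_smul hsw ν⁻¹)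
  have h2 := (hasGlobalKatoSolution_smul_iff (u₀ := u₀) (ν := ν) (inv_pos.2 hν)).1
  rw [inv_mul_cancel₀ hν.ne'] at h2
  exact h2 h1

/-- **The swirl-free stratum of the crux `AxisymmetricKatoGlobal`**: for every `ν > 0`, every
weakly divergence-free, axisymmetric (`∀ θ x, u₀ (R_θ x) = R_θ (u₀ x)`), swirl-free `u₀ ∈ L³` has a
global Kato solution. -/
theorem axisymmetricKatoGlobal_noSwirl_stratum :
    ∀ ν : ℝ, 0 < ν → ∀ u₀ : EuclideanSpace ℝ (Fin 3) → EuclideanSpace ℝ (Fin 3),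
      MemLp u₀ 3 volume → IsWeaklyDivFree u₀ →
      (∀ (θ : ℝ) (x : EuclideanSpace ℝ (Fin 3)), u₀ (rotZ θ x) = rotZ θ (u₀ x)) → HasNoSwirl u₀ →
      HasGlobalKatoSolution ν u₀ :=
  fun _ hν _ hu₀ hdiv hax hsw =>
    hasGlobalKatoSolution_of_isAxisymmetric_hasNoSwirl_viscosity hν hu₀ hdiv (fun θ x => hax θ x) hsw

end Summit.NavierStokesRegularity.NavierStokesRegularity.Theorems.AxisymmetricKatoGlobal.NoSwirlStratum

end
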